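/-
Copyright (c) 2026 the pub-hodgecm-mathlib formalisation cell (harness21).  Prover seat hodgecm-mathlib-K2E4-p14 (g6), Track B ∕ K2-LIT, h413 =
`stmt-HodgeConjecture-24833`, line `K2_E1_TraceFormulaBeta`, campaign «EIS-WHITTAKER-2», deck #4 «W5-FINAL», sibling file of LAYER 1 (dealer K2E1-plan (g5) 2026-09-04T08:06:19Z (i);
FINAL RULING g4 «W5 DIVISION» 07:56:16Z (3)).
-/
import Summits.HodgeConjecture.HodgeConjecture.Theorems.K2E1SphericalEisensteinContinuationU2Final   -- ★ p858453 (this seat): LAYER 1 `sphericalEisenstein_continuation_cm_two_of_whittaker`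
import Summits.HodgeConjecture.HodgeConjecture.Theorems.K2E1EisensteinMinusConstantTermPoissonU2      -- ★ W1 (K2E1-p09 g4): `eisensteinSeriesU_sub_borelConstantTerm_eq_two`
import Summits.HodgeConjecture.HodgeConjecture.Theorems.K2E1FlatSectionLineRestrictionU2            -- ★ (D1-c) I (K2E1-p09): `hΦc`, `hΦi`, `hloc` along the line
import Summits.HodgeConjecture.HodgeConjecture.Theorems.K2E1UnipotentHaarNormalisationU2            -- ★ (D1-a): `hnorm` `inv_measure_smul_integral_weylLong_eq_two`, `isInvInvariant_of_isHaarMeasure_two`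
import HarnessLib

/-!
# K2·E1 — `K2E1SphericalEisensteinContinuationU2FinalFourier`: THE FOURIER LETTER OF «W5-FINAL» — `E(φ₀H^z)(g) − E(φ₀H^z)_B(g) = μ(D)⁻¹·Σ_{ξ≠0} 𝓕Φ_{g,z}(ξ)` AT THE CM PAIR ON `Re z > 1`,
# EVERY HYPOTHESIS OF W1 DISCHARGED BUT THE FOURIER-SIDE SUMMABILITY `hsum` (sibling of ★ LAYER 1 p858453; FINAL RULING «W5 DIVISION» (3))

Track B ∕ K2-LIT, crux h413 = `stmt-HodgeConjecture-24833`, route of record `HCCMUnconditional`; cell `hodgecm-mathlib`, squad K2, ENGINE E1.  Prover seat `hodgecm-mathlib-K2E4-p14` (g6).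
THEOREMS ONLY (no `def`, no `instance`, no notation, no named-fact hypothesis, no `sorry`); lane `--supports stmt-HodgeConjecture-24833 --as helper` (count-neutral).  Closes no socket.

THE MATHEMATICS [MoeglinWaldspurger1995, II.1.7; Garrett2018, §2.8–§2.9; CasselsFrohlichANT1967, Ch. XV 4.2.4].  W1 ★ `eisensteinSeriesU_sub_borelConstantTerm_eq_two` is hypothesis-first (eleven
hypotheses).  At the CM pair `(L⁺, L)` and the SPHERICAL flat section `f_z = φ₀·H^z`, `Re z > 1`, ten of them are theorems of the tree: `f_z` Borel, left-`N(𝔸)`∕`B(L⁺)`-invariant (★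
`borelHeight_unipotent_mul`, ★ `borelHeight_arithmeticBorel_mul`); `N(𝔸)` inversion-invariant ★ `isInvInvariant_of_isHaarMeasure_two`; `0 < ν(𝓕) < ∞` (★ `measure_ne_zero_of_isFundamentalDomain_rationalUnipotent`,
compact closure); Godement's `hfin` ★ `hfin_of_locallyUniformMajorant` ∘ ★ `exists_locallyUniform_majorant_flatSectionU_cm_two`; the summability `hs` ★ `summable_flatSectionU_cm_two`; the big-cell
function `Φ_{g,z}(t) := f_z(ι(w₀)·n(θt)·g)` continuous ★ `continuous_weylLong_mul_line_mul`, integrable ★ `integrable_weylLong_mul_line_mul_two`, with Poisson's locally uniform lattice majorant ★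
`exists_summable_majorant_line_translate_two`; the covolume normalisation `hnorm` ★ `inv_measure_smul_integral_weylLong_eq_two` (every additive Haar `μ` of `𝔸_{L⁺}`).  The ELEVENTH,
`hsum : Σ_ξ ‖𝓕Φ_{g,z}(ξ)‖ < ∞`, is the FOURIER-SIDE letter — paid by the Whittaker package (K2E3-p12 (g6)'s ★ A `K2E1LocalWhittakerContinuationU2` + C `K2E1WhittakerBoundsAssemblyU2` head
`exists_whittaker_continuation_cm_two`: `W z ξ = μ(D)⁻¹·𝓕Φ_{g,z}(ξ)` on `Re z > 1` with W4's bounds ⟹ ★ W4 lattice M-test) in the closing edition.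
§1 **`eisensteinSeriesU_sub_borelConstantTerm_spherical_cm_two`** — `E(φ₀H^z)(g) − E(φ₀H^z)_B(g) = μ(D)⁻¹·Σ'_ξ 𝟙_{ξ≠0}·𝓕Φ_{g,z}(ξ)` (`Re z > 1`, any additive Haar `μ` on `𝔸_{L⁺}`, `D` Tate's domain),
letter `hsum` only.  §2 **`sphericalEisenstein_continuation_cm_two_of_whittaker'`** — ★ LAYER 1 with its Fourier letter `hFourier` REPLACED by `hsum` + the identification letter
`hWeq : ∀ z, 1 < Re z → ∀ ξ ≠ 0, W z ξ = μ(D)⁻¹·𝓕Φ_{g,z}(ξ)` (K2E3-p12's head clause, `κ = 1`): survivors `hWhol hWbd hWeq hsum` — the four clauses of ONE ★-in-flight head.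
HONEST LABEL: HC_CM is proved only modulo the 7 printed citations (2 remaining named inputs: hLiu418 = `stmt-HodgeConjecture-24832`, h413 = `stmt-HodgeConjecture-24833`) until rung 0
closes; this file asserts no named fact and closes no socket.
References: [MoeglinWaldspurger1995] II.1.7 · [Garrett2018] §2.8–§2.9 · [CasselsFrohlichANT1967] Ch. XV Lemma 4.2.4 · [Bump1997] §3.7.
-/

set_option autoImplicit false
-- the mandated namespace repeats the single-problem summit's segment (`HodgeConjecture.HodgeConjecture`)
set_option linter.dupNamespace false

noncomputable section

open MeasureTheory Measure NumberField NumberField.mixedEmbedding IsDedekindDomain Set Filter Module MulAction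
open scoped ENNReal NNReal Topology Classical
open Literature.NumberTheory.Automorphic Literature.NumberTheory.Automorphic.UnitaryGroup AdelicGroupData
open Summit.HodgeConjecture.HodgeConjecture.Cruxes.H413.K2E1BorelEisensteinU
open Summit.HodgeConjecture.HodgeConjecture.Cruxes.H413.K2E1MaassSelbergBracketsThree (measurable_flatSectionU)
open Summit.HodgeConjecture.HodgeConjecture.Cruxes.H413.K2E1SphericalEisensteinContinuationU2Final
open Summit.HodgeConjecture.HodgeConjecture.Cruxes.H413.K2E1EisensteinMinusConstantTermPoissonU2 (eisensteinSeriesU_sub_borelConstantTerm_eq_two)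
open Summit.HodgeConjecture.HodgeConjecture.Cruxes.H413.K2E1FlatSectionLineRestrictionU2 (continuous_weylLong_mul_line_mul integrable_weylLong_mul_line_mul_two exists_summable_majorant_line_translate_two)
open Summit.HodgeConjecture.HodgeConjecture.Cruxes.H413.K2E1UnipotentHaarNormalisationU2 (inv_measure_smul_integral_weylLong_eq_two isInvInvariant_of_isHaarMeasure_two)
open Summit.HodgeConjecture.HodgeConjecture.Cruxes.H413.K2E1EisensteinAnalyticBinders (hfin_of_locallyUniformMajorant)
open Summit.HodgeConjecture.HodgeConjecture.Cruxes.H413.K2E1BorelEisensteinGodementCMTwo (exists_locallyUniform_majorant_flatSectionU_cm_two)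
open Summit.HodgeConjecture.HodgeConjecture.Cruxes.H413.K2E1MaassSelbergCMTwo (summable_flatSectionU_cm_two)
open Summit.HodgeConjecture.HodgeConjecture.Cruxes.H413.K2E1BorelCosetsDictionary (forall_arithmeticBorel_iff)

namespace Summit.HodgeConjecture.HodgeConjecture.Cruxes.H413.K2E1SphericalEisensteinContinuationU2FinalFourier

variable (L : Type) [Field L] [NumberField L] [IsCMField L]
variable (hij : (((0 : Fin 2) : ℕ)) + 1 = ((1 : Fin 2) : ℕ)) (hN : 2 = 2 * ((0 : Fin 2) : ℕ) + 2)
variable [MeasurableSpace (quasiSplit (↥(maximalRealSubfield L)) L (IsCMField.complexConj L) 2).Adelic] [BorelSpace (quasiSplit (↥(maximalRealSubfield L)) L (IsCMField.complexConj L) 2).Adelic]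
variable [MeasurableSpace (AdeleRing (𝓞 ↥(maximalRealSubfield L)) ↥(maximalRealSubfield L))] [BorelSpace (AdeleRing (𝓞 ↥(maximalRealSubfield L)) ↥(maximalRealSubfield L))]

/-! ## §1 W1 at the CM pair for the spherical flat section: ten hypotheses discharged, `hsum` named -/

/-- **`E(φ₀H^z)(g) − E(φ₀H^z)_B(g) = μ(D)⁻¹ · Σ'_ξ 𝟙_{ξ≠0} 𝓕Φ_{g,z}(ξ)`** at the CM pair, `Re z > 1`, `Φ_{g,z}(t) = φ₀·H(ι(w₀)·n(θt)·g)^z`, for every additive Haar measure `μ` of `𝔸_{L⁺}` (`D` Tate's domain)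
— ★ W1 with its hypotheses discharged by name (module docstring) except the Fourier-side summability `hsum : Σ_ξ ‖𝓕Φ_{g,z}(ξ)‖ < ∞`. [cite: MoeglinWaldspurger1995, II.1.7] [cite: Garrett2018, §2.8]
[cite: CasselsFrohlichANT1967, Ch. XV Lemma 4.2.4] -/
theorem eisensteinSeriesU_sub_borelConstantTerm_spherical_cm_two {δ : L} (hcδ : IsCMField.complexConj L δ = -δ) (hδ : δ ≠ 0)
    (ν : Measure ↥(adelicUnipotent (↥(maximalRealSubfield L)) L (IsCMField.complexConj L) 2)) [ν.IsHaarMeasure]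
    {𝓕 : Set ↥(adelicUnipotent (↥(maximalRealSubfield L)) L (IsCMField.complexConj L) 2)} (h𝓕N : IsFundamentalDomain ↥(rationalUnipotent (↥(maximalRealSubfield L)) L (IsCMField.complexConj L) 2) 𝓕 ν) (h𝓕c : IsCompact (closure 𝓕))
    (μ : Measure (AdeleRing (𝓞 ↥(maximalRealSubfield L)) ↥(maximalRealSubfield L))) [μ.IsAddHaarMeasure] (φ₀ : ℂ) {z : ℂ} (hz : 1 < z.re) (g : (quasiSplit (↥(maximalRealSubfield L)) L (IsCMField.complexConj L) 2).Adelic)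
    (hsum : Summable fun ξ : ↥(maximalRealSubfield L) => ‖adeleFourierCoeff μ (fun t : AdeleRing (𝓞 ↥(maximalRealSubfield L)) ↥(maximalRealSubfield L) =>
      flatSectionU (fun _ : (quasiSplit (↥(maximalRealSubfield L)) L (IsCMField.complexConj L) 2).Adelic => φ₀) z (((quasiSplit (↥(maximalRealSubfield L)) L (IsCMField.complexConj L) 2).toAdelic (weylLongU ((IsCMField.complexConj L : L ≃ₐ[↥(maximalRealSubfield L)] L) : L →+* L) (rfl : ((StdForm.antidiagonal 2).over L) = ((StdForm.antidiagonal 2).over L)))) * ((middleRootUnipotent hij hN (Multiplicative.ofAdd (traceZeroLine ↥(maximalRealSubfield L) L (IsCMField.complexConj L) hcδ hδ t)) : ↥(adelicUnipotent (↥(maximalRealSubfield L)) L (IsCMField.complexConj L) 2)) : (quasiSplit (↥(maximalRealSubfield L)) L (IsCMField.complexConj L) 2).Adelic) * g)) ξ‖) :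
    eisensteinSeriesU (flatSectionU (fun _ : (quasiSplit (↥(maximalRealSubfield L)) L (IsCMField.complexConj L) 2).Adelic => φ₀) z) g - borelConstantTerm ν 𝓕 (eisensteinSeriesU (flatSectionU (fun _ : (quasiSplit (↥(maximalRealSubfield L)) L (IsCMField.complexConj L) 2).Adelic => φ₀) z)) g =
      ((μ (adeleFundamentalDomain ↥(maximalRealSubfield L))).toReal⁻¹ : ℂ) *
        ∑' ξ : ↥(maximalRealSubfield L), ({0}ᶜ : Set ↥(maximalRealSubfield L)).indicator
          (adeleFourierCoeff μ (fun t : AdeleRing (𝓞 ↥(maximalRealSubfield L)) ↥(maximalRealSubfield L) => flatSectionU (fun _ : (quasiSplit (↥(maximalRealSubfield L)) L (IsCMField.complexConj L) 2).Adelic => φ₀) z (((quasiSplit (↥(maximalRealSubfield L)) L (IsCMField.complexConj L) 2).toAdelic (weylLongU ((IsCMField.complexConj L : L ≃ₐ[↥(maximalRealSubfield L)] L) : L →+* L) (rfl : ((StdForm.antidiagonal 2).over L) = ((StdForm.antidiagonal 2).over L)))) * ((middleRootUnipotent hij hN (Multiplicative.ofAdd (traceZeroLine ↥(maximalRealSubfield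 L) L (IsCMField.complexConj L) hcδ hδ t)) : ↥(adelicUnipotent (↥(maximalRealSubfield L)) L (IsCMField.complexConj L) 2)) : (quasiSplit (↥(maximalRealSubfield L)) L (IsCMField.complexConj L) 2).Adelic) * g))) ξ := by
  haveI := t2Space_adeleRing_of_numberField L
  haveI := locallyCompactSpace_adeleRing' L
  letI : MeasurableSpace (AdeleRing (𝓞 L) L) := borel _
  haveI : BorelSpace (AdeleRing (𝓞 L) L) := ⟨rfl⟩
  haveI : T2Space (quasiSplit (↥(maximalRealSubfield L)) L (IsCMField.complexConj L) 2).Adelic := inferInstanceAs (T2Space (adelic (↥(maximalRealSubfield L)) L (IsCMField.complexConj L) 2 ((StdForm.antidiagonal 2).over L)))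
  haveI : ν.IsInvInvariant := isInvInvariant_of_isHaarMeasure_two ν
  have hc : IsCMField.complexConj L * IsCMField.complexConj L = 1 := AlgEquiv.ext fun x => IsCMField.complexConj_apply_apply L x
  have h𝓕₀ : ν 𝓕 ≠ 0 := measure_ne_zero_of_isFundamentalDomain_rationalUnipotent ν h𝓕N
  have h𝓕top : ν 𝓕 ≠ ∞ := ((measure_mono subset_closure).trans_lt h𝓕c.measure_lt_top).ne
  -- the spherical flat section: Borel, left-`N(𝔸)`∕`B(L⁺)`-invariant, Godement-finite, summable along the big cell
  have hfm : Measurable (flatSectionU (fun _ : (quasiSplit (↥(maximalRealSubfield L)) L (IsCMField.complexConj L) 2).Adelic => φ₀) z) := measurable_flatSectionU measurable_const z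
  have hfc : Continuous (flatSectionU (fun _ : (quasiSplit (↥(maximalRealSubfield L)) L (IsCMField.complexConj L) 2).Adelic => φ₀) z) := continuous_flatSectionU continuous_const z
  have hfN : ∀ (n : ↥(adelicUnipotent (↥(maximalRealSubfield L)) L (IsCMField.complexConj L) 2)) (y : (quasiSplit (↥(maximalRealSubfield L)) L (IsCMField.complexConj L) 2).Adelic), flatSectionU (fun _ : (quasiSplit (↥(maximalRealSubfield L)) L (IsCMField.complexConj L) 2).Adelic => φ₀) z ((n : (quasiSplit (↥(maximalRealSubfield L)) L (IsCMField.complexConj L) 2).Adelic) * y) = flatSectionU (fun _ : (quasiSplit (↥(maximalRealSubfield L)) L (IsCMField.complexConj L) 2).Adelic => φ₀) z y := fun n y => by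
    rw [flatSectionU_apply, flatSectionU_apply, borelHeight_unipotent_mul n.2 y]
  have hfB : ∀ b ∈ borelU ((IsCMField.complexConj L : L ≃ₐ[↥(maximalRealSubfield L)] L) : L →+* L) ((StdForm.antidiagonal 2).over L), ∀ x : (quasiSplit (↥(maximalRealSubfield L)) L (IsCMField.complexConj L) 2).Adelic,
      flatSectionU (fun _ : (quasiSplit (↥(maximalRealSubfield L)) L (IsCMField.complexConj L) 2).Adelic => φ₀) z ((quasiSplit (↥(maximalRealSubfield L)) L (IsCMField.complexConj L) 2).toAdelic b * x) = flatSectionU (fun _ : (quasiSplit (↥(maximalRealSubfield L)) L (IsCMField.complexConj L) 2).Adelic => φ₀) z x :=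
    forall_arithmeticBorel_iff.1 fun b hb x => by rw [flatSectionU_apply, flatSectionU_apply, K2E1TruncatedEisensteinExplicit.borelHeight_arithmeticBorel_mul hb]
  have hmaj := exists_locallyUniform_majorant_flatSectionU_cm_two L hz (φ := fun _ : (quasiSplit (↥(maximalRealSubfield L)) L (IsCMField.complexConj L) 2).Adelic => φ₀) (M := ‖φ₀‖) (fun x => le_rfl)
  have hfin := fun y : (quasiSplit (↥(maximalRealSubfield L)) L (IsCMField.complexConj L) 2).Adelic => hfin_of_locallyUniformMajorant ν hfB (fun q => hfc.comp (continuous_const.mul continuous_id)) hmaj h𝓕c y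
  have hs := summable_flatSectionU_cm_two L hz (φ := fun _ : (quasiSplit (↥(maximalRealSubfield L)) L (IsCMField.complexConj L) 2).Adelic => φ₀) (C := ‖φ₀‖) (fun x => le_rfl) g
  -- the big-cell function along the line: continuous, integrable, locally uniformly majorised along the lattice; the covolume normalisation
  have hΦc := continuous_weylLong_mul_line_mul hij hN hcδ hδ hfc g
  have hΦi := integrable_weylLong_mul_line_mul_two hij hN hcδ hδ μ ν hfm hfN hfB h𝓕N g (hfin g)
  have hloc := fun (C : Set (AdeleRing (𝓞 ↥(maximalRealSubfield L)) ↥(maximalRealSubfield L))) (hC : IsCompact C) =>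
    exists_summable_majorant_line_translate_two hij hN hcδ hδ hfB hmaj hC g
  have hnorm := inv_measure_smul_integral_weylLong_eq_two hij hN hcδ hδ hc μ ν h𝓕N (flatSectionU (fun _ : (quasiSplit (↥(maximalRealSubfield L)) L (IsCMField.complexConj L) 2).Adelic => φ₀) z) g
  exact eisensteinSeriesU_sub_borelConstantTerm_eq_two hij hN hcδ hδ ν hfm hfN hfB h𝓕N h𝓕₀ h𝓕top g (hfin g) hs μ (fun t => rfl) hΦc hΦi hloc hsum hnorm

/-! ## §2 LAYER 1 re-keyed: the Fourier letter split into `hsum` (W4-payable) and the identification `hWeq` (K2E3-p12's head clause) -/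

/-- **«(H4-b)₂-sph» AT THE CM PAIR, keyed to the Whittaker package**: ★ LAYER 1 `sphericalEisenstein_continuation_cm_two_of_whittaker` (`κ = 1`) with its Fourier letter DISCHARGED by §1
modulo (a) the Fourier-side summability `hsum : ∀ z, 1 < Re z → Σ_ξ ‖𝓕Φ_{g,z}(ξ)‖ < ∞` and (b) the identification `hWeq : ∀ z, 1 < Re z → ∀ ξ ≠ 0, W z ξ = μ(D)⁻¹·𝓕Φ_{g,z}(ξ)` — together with
`hWhol`, `hWbd` these are the four clauses of K2E3-p12 (g6)'s head `exists_whittaker_continuation_cm_two` (FINAL RULING «W5 DIVISION»); (a) follows from (b) + `hWbd` by ★ W4's lattice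
M-test in the closing edition.  Conclusion: `∃ Ec r, r ≠ 0 ∧ MeromorphicOn Ec {½ < Re} ∧ DifferentiableOn ℂ Ec ({½ < Re} ∖ {1}) ∧ (1 < Re z → Ec z = E(φ₀H^z)(g)) ∧ (z−1)·Ec z → φ₀·r`.
[cite: Garrett2018, §1.10–§1.12 and §2.8–§2.11] [cite: Bump1997, §3.7] [cite: MoeglinWaldspurger1995, IV.1] -/
theorem sphericalEisenstein_continuation_cm_two_of_whittaker' {δ : L} (hcδ : IsCMField.complexConj L δ = -δ) (hδ : δ ≠ 0)
    (ν : Measure ↥(adelicUnipotent (↥(maximalRealSubfield L)) L (IsCMField.complexConj L) 2)) [ν.IsHaarMeasure]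
    {𝓕 : Set ↥(adelicUnipotent (↥(maximalRealSubfield L)) L (IsCMField.complexConj L) 2)} (h𝓕N : IsFundamentalDomain ↥(rationalUnipotent (↥(maximalRealSubfield L)) L (IsCMField.complexConj L) 2) 𝓕 ν) (h𝓕c : IsCompact (closure 𝓕))
    (μ : Measure (AdeleRing (𝓞 ↥(maximalRealSubfield L)) ↥(maximalRealSubfield L))) [μ.IsAddHaarMeasure] (φ₀ : ℂ) (g : (quasiSplit (↥(maximalRealSubfield L)) L (IsCMField.complexConj L) 2).Adelic) (W : ℂ → ↥(maximalRealSubfield L) → ℂ)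
    (hWhol : ∀ ξ : ↥(maximalRealSubfield L), ξ ≠ 0 → DifferentiableOn ℂ (fun z => W z ξ) {z : ℂ | 1 / 2 < z.re})
    (hWbd : ∀ z₀ ∈ {z : ℂ | 1 / 2 < z.re}, ∃ V ∈ 𝓝 z₀, ∃ (M b a : ℝ) (Cf : Set (FiniteAdeleRing (𝓞 ↥(maximalRealSubfield L)) ↥(maximalRealSubfield L))), 0 ≤ M ∧ 0 < b ∧ IsCompact Cf ∧
      ∀ z ∈ V, ∀ ξ : ↥(maximalRealSubfield L),
        ‖W z ξ‖ ≤ M * Real.exp (-(b * ‖InfiniteAdeleRing.ringEquiv_mixedSpace ↥(maximalRealSubfield L) (algebraMap ↥(maximalRealSubfield L) (AdeleRing (𝓞 ↥(maximalRealSubfield L)) ↥(maximalRealSubfield L)) ξ).1‖)) *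
          (1 + ‖InfiniteAdeleRing.ringEquiv_mixedSpace ↥(maximalRealSubfield L) (algebraMap ↥(maximalRealSubfield L) (AdeleRing (𝓞 ↥(maximalRealSubfield L)) ↥(maximalRealSubfield L)) ξ).1‖) ^ a ∧
        ((algebraMap ↥(maximalRealSubfield L) (AdeleRing (𝓞 ↥(maximalRealSubfield L)) ↥(maximalRealSubfield L)) ξ).2 ∉ Cf → W z ξ = 0))
    (hWeq : ∀ z : ℂ, 1 < z.re → ∀ ξ : ↥(maximalRealSubfield L), ξ ≠ 0 →
      W z ξ = ((μ (adeleFundamentalDomain ↥(maximalRealSubfield L))).toReal⁻¹ : ℂ) *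
        adeleFourierCoeff μ (fun t : AdeleRing (𝓞 ↥(maximalRealSubfield L)) ↥(maximalRealSubfield L) => flatSectionU (fun _ : (quasiSplit (↥(maximalRealSubfield L)) L (IsCMField.complexConj L) 2).Adelic => φ₀) z (((quasiSplit (↥(maximalRealSubfield L)) L (IsCMField.complexConj L) 2).toAdelic (weylLongU ((IsCMField.complexConj L : L ≃ₐ[↥(maximalRealSubfield L)] L) : L →+* L) (rfl : ((StdForm.antidiagonal 2).over L) = ((StdForm.antidiagonal 2).over L)))) * ((middleRootUnipotent hij hN (Multiplicative.ofAdd (traceZeroLine ↥(maximalRealSubfield L) L (IsCMField.complexConj L) hcδ hδ t)) : ↥(adelicUnipotent (↥(maximalRealSubfield L)) L (IsCMField.complexConj L) 2)) : (quasiSplit (↥(maximalRealSubfield L)) L (IsCMField.complexConj L) 2).Adelic) * g)) ξ)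
    (hsum : ∀ z : ℂ, 1 < z.re → Summable fun ξ : ↥(maximalRealSubfield L) => ‖adeleFourierCoeff μ (fun t : AdeleRing (𝓞 ↥(maximalRealSubfield L)) ↥(maximalRealSubfield L) =>
      flatSectionU (fun _ : (quasiSplit (↥(maximalRealSubfield L)) L (IsCMField.complexConj L) 2).Adelic => φ₀) z (((quasiSplit (↥(maximalRealSubfield L)) L (IsCMField.complexConj L) 2).toAdelic (weylLongU ((IsCMField.complexConj L : L ≃ₐ[↥(maximalRealSubfield L)] L) : L →+* L) (rfl : ((StdForm.antidiagonal 2).over L) = ((StdForm.antidiagonal 2).over L)))) * ((middleRootUnipotent hij hN (Multiplicative.ofAdd (traceZeroLine ↥(maximalRealSubfield L) L (IsCMField.complexConj L) hcδ hδ t)) : ↥(adelicUnipotent (↥(maximalRealSubfield L)) L (IsCMField.complexConj L) 2)) : (quasiSplit (↥(maximalRealSubfield L)) L (IsCMField.complexConj L) 2).Adelic) * g)) ξ‖) :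
    ∃ (Ec : ℂ → ℂ) (r : ℂ), r ≠ 0 ∧ MeromorphicOn Ec {z : ℂ | 1 / 2 < z.re} ∧ DifferentiableOn ℂ Ec ({z : ℂ | 1 / 2 < z.re} \ {1}) ∧
      (∀ z : ℂ, 1 < z.re → Ec z = eisensteinSeriesU (flatSectionU (fun _ : (quasiSplit (↥(maximalRealSubfield L)) L (IsCMField.complexConj L) 2).Adelic => φ₀) z) g) ∧
      Tendsto (fun z : ℂ => (z - 1) * Ec z) (𝓝[≠] 1) (𝓝 (φ₀ * r)) := by
  refine sphericalEisenstein_continuation_cm_two_of_whittaker L hcδ hδ ν h𝓕N h𝓕c φ₀ 1 g W hWhol hWbd fun z hz => ?_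
  rw [eisensteinSeriesU_sub_borelConstantTerm_spherical_cm_two L hij hN hcδ hδ ν h𝓕N h𝓕c μ φ₀ hz g (hsum z hz), one_mul, ← tsum_mul_left]
  refine tsum_congr fun ξ => ?_
  by_cases hξ : ξ = 0
  · rw [indicator_of_notMem (show ξ ∉ ({0}ᶜ : Set ↥(maximalRealSubfield L)) from fun h => h hξ),
      indicator_of_notMem (show ξ ∉ ({0}ᶜ : Set ↥(maximalRealSubfield L)) from fun h => h hξ), mul_zero]
  · rw [indicator_of_mem (show ξ ∈ ({0}ᶜ : Set ↥(maximalRealSubfield L)) from hξ), indicator_of_mem (show ξ ∈ ({0}ᶜ : Set ↥(maximalRealSubfield L)) from hξ), hWeq z hz ξ hξ]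

end Summit.HodgeConjecture.HodgeConjecture.Cruxes.H413.K2E1SphericalEisensteinContinuationU2FinalFourier

end
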